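import Summits.QuantumFields.YangMills.Theorems.LuscherReductionDressedRitzPolyakovLiftBlockPosition
import HarnessLib

/-!
# Route `LuscherReduction`, item `DressedRitz` (stmt-QuantumFields-20205), line «polyakovlift» r8 — the dynamic core from block data, part A: PURE-REAL side
# lemmas (pair centre, quotient form of the doors, (o6) end-game arithmetic) (LEAD prover ym-lead-20205-polyakovlift g4; `--supports stmt-QuantumFields-20205`)

Per-basis theorem (fixed lattice `L`, coupling `β > 0`, raw vacuum `φ`, basis `g`; `v_i = liftVec β φ g_i`, `u_i = dressedLiftFamily β φ g i = K^{L} v_i`, block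
`P = K^{L}`): the FINE dynamic core `DynamicCoreClauses k C β u` — (o5) at `e^{Cλ²/L}`, (o6) at `C(λ²/L)λ₀‖u_i‖‖u_l‖` — follows from
* the block defects of `v_i` (raw) and `u_i` (dressed) `≤ δ ≤ 1/32` (text `BlockLeakageForL`),
* BLOCK POSITION (B5) at `e^{a}` and (B6) at `E·λ₀^L` (text `BlockPositionForL`),
* STATICS (o2) `|⟨u_i,u_l⟩| ≤ s‖u_i‖‖u_l‖` (text `StaticsForL`),
* SIDE CONDITIONS on the block Rayleigh quotients `X_i = ⟨u_i,Pu_i⟩/‖u_i‖²`: comparability `X_i ≤ Θ₁X_l`, mismatch `|X_i − X_l| ≤ ηX_l` (`η ≤ 1`), top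
  `λ₀^L ≤ Θ₁X_i` — consequences of (B5) and the one-site level package of the closed crux ONE (`PScal.levels_package`: `(μ_j/μ_0)^L = e^{−(ε_{j+1}−ε_1)λ ± O(λ²/L)}`),
  to be discharged in the `…ForL` assembly (next file, w1a WAKE W4-A),
provided `a + 15δ ≤ Cλ²` and `2Θ₁E + 2Θ₁(η+15δ)s + (512Θ₁⁴+16Θ₁)δ + 512Θ₁²(η+15δ)² ≤ Cλ²`:

* THIS FILE (part A, pure real): `pair_centre` (side conditions of the cross door for a pair from the per-channel ones), `quot_pow_bounds`, `o6_numeric`;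
  part B (`…BlockPositionGlue.lean`): ★ `o5_clause`, ★ `o6_clause`, ★★ `dynamicCoreClauses_of_block`.

HONEST FRAMING: door algebra on a fixed lattice for the CONDITIONAL femto rung R2b1; every block text it consumes is an OPEN renormalisation-group estimate; nothing here
bears on infinite volume, the continuum limit or the Clay gap.  References: M. Lüscher, NPB 219 (1983) 233 [cite: Luscher1983, §3]; Lüscher–Wolff [cite: LuscherWolff1990].
-/

set_option autoImplicit false

noncomputable section

open MeasureTheory Filter Topology Real
open Literature.MathematicalPhysics.QuantumFieldTheory (GaugeConfig Site gaugeTransform)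
open scoped BigOperators

namespace Summit.QuantumFields.YangMills.Theorems.FemtoTransferGap.PolyakovLift

open Summit.QuantumFields.YangMills.Theorems.FemtoTransferGap

/-! ## §1 Pure real: the pair's centre from the per-channel data -/

/-- `e^{15δ} ≤ 2`, `1 − 15δ ≤ e^{−15δ}` and `1/2 ≤ e^{−15δ}` for `0 ≤ δ ≤ 1/32`. [folklore] -/
theorem exp_fifteen_delta_le {δ : ℝ} (hδ : δ ≤ 1 / 32) :
    Real.exp (15 * δ) ≤ 2 ∧ 1 - 15 * δ ≤ Real.exp (-(15 * δ)) ∧ 1 / 2 ≤ Real.exp (-(15 * δ)) := by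
  have h1 : 15 * δ ≤ 1 / 2 := by linarith
  have hlog2 : (1 : ℝ) / 2 ≤ Real.log 2 := by
    have := Real.log_two_gt_d9; linarith
  refine ⟨?_, ?_, ?_⟩
  · calc Real.exp (15 * δ) ≤ Real.exp (Real.log 2) := Real.exp_le_exp.2 (by linarith)
      _ = 2 := Real.exp_log two_pos
  · have := Real.add_one_le_exp (-(15 * δ)); linarith
  · have := Real.add_one_le_exp (-(15 * δ)); linarith

/-- Squares from two-sided bounds: `−b ≤ a ≤ b ⟹ a² ≤ b²`. [folklore] -/
theorem sq_le_sq_of_abs_le {a b : ℝ} (h1 : -b ≤ a) (h2 : a ≤ b) : a ^ 2 ≤ b ^ 2 := sq_le_sq' h1 h2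

/-- ★ PAIR CENTRE.  Two channels with block quotients `X, X' > 0`, fine quotients `y, y' ≥ 0` obeying the doors `e^{−15δ}X ≤ y^L ≤ X` (same primed), comparability
`X ≤ Θ₁X'`, `X' ≤ Θ₁X`, mismatch `|X − X'| ≤ ηX'`, `|X' − X| ≤ ηX` (`0 ≤ η`), top `T ≤ Θ₁X`, `T ≤ Θ₁X'`.  With `X₀ = ((y+y')/2)^L`, `M̄ = (X+X')/2`:
`0 < X₀`, `X ≤ 2Θ₁X₀`, `X₀ ≤ 2Θ₁X`, (same primed), `T ≤ 2Θ₁X₀`, `(X/X₀ − 1)² ≤ 4(η+15δ)²` (same primed), `|X₀ − M̄| ≤ (η+15δ)(2Θ₁)X₀`. [folklore] -/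
theorem pair_centre {X X' y y' T Θ₁ η δ : ℝ} {L : ℕ} (hX : 0 < X) (hX' : 0 < X') (hy : 0 ≤ y) (hy' : 0 ≤ y') (hΘ₁ : 1 ≤ Θ₁)
    (hη0 : 0 ≤ η) (hδ0 : 0 ≤ δ) (hδ : δ ≤ 1 / 32)
    (h1 : Real.exp (-(15 * δ)) * X ≤ y ^ L) (h2 : y ^ L ≤ X) (h1' : Real.exp (-(15 * δ)) * X' ≤ y' ^ L) (h2' : y' ^ L ≤ X')
    (hc : X ≤ Θ₁ * X') (hc' : X' ≤ Θ₁ * X) (hm : |X - X'| ≤ η * X') (hm' : |X' - X| ≤ η * X) (hT : T ≤ Θ₁ * X) (hT' : T ≤ Θ₁ * X') :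
    let X0 := ((y + y') / 2) ^ L
    0 < X0 ∧ X ≤ 2 * Θ₁ * X0 ∧ X0 ≤ 2 * Θ₁ * X ∧ X' ≤ 2 * Θ₁ * X0 ∧ X0 ≤ 2 * Θ₁ * X' ∧ T ≤ 2 * Θ₁ * X0 ∧
      (X / X0 - 1) ^ 2 ≤ 4 * (η + 15 * δ) ^ 2 ∧ (X' / X0 - 1) ^ 2 ≤ 4 * (η + 15 * δ) ^ 2 ∧
      |X0 - (X + X') / 2| ≤ (η + 15 * δ) * (2 * Θ₁) * X0 := by
  intro X0
  obtain ⟨-, hE1, hEhalf⟩ := exp_fifteen_delta_le hδ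
  obtain ⟨hlo, hhi⟩ := centre_between (b := 15 * δ) hy hy' h1 h2 h1' h2'
  have hΘ0 : 0 ≤ Θ₁ := by linarith
  -- min / max bookkeeping (case on X ≤ X')
  have hmin0 : 0 < min X X' := lt_min hX hX'
  have hX0lo : Real.exp (-(15 * δ)) * min X X' ≤ X0 := hlo
  have hX0hi : X0 ≤ max X X' := hhi
  have hX0pos : 0 < X0 := lt_of_lt_of_le (mul_pos (Real.exp_pos _) hmin0) hX0lo
  have hX0lo' : (1 - 15 * δ) * min X X' ≤ X0 := le_trans (mul_le_mul_of_nonneg_right hE1 hmin0.le) hX0lo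
  have hX0min : min X X' ≤ 2 * X0 := by
    have := mul_le_mul_of_nonneg_right hEhalf hmin0.le; linarith
  have hmX : X - X' ≤ η * X' := (abs_le.1 hm).2
  have hmX2 : X' - X ≤ η * X := (abs_le.1 hm').2
  -- facts depending on the order of X, X'
  have hfacts : X ≤ Θ₁ * min X X' ∧ X' ≤ Θ₁ * min X X' ∧ max X X' ≤ Θ₁ * X ∧ max X X' ≤ Θ₁ * X' ∧ T ≤ Θ₁ * min X X' ∧
      max X X' ≤ min X X' + η * min X X' ∧ min X X' ≤ (X + X') / 2 ∧ (X + X') / 2 ≤ max X X' ∧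
      X0 - X ≤ η * X0 ∧ X0 - X' ≤ η * X0 := by
    have hηX0 : ∀ Z : ℝ, Z ≤ X0 → η * Z ≤ η * X0 := fun Z hZ => mul_le_mul_of_nonneg_left hZ hη0
    rcases le_total X X' with h | h
    · rw [min_eq_left h, max_eq_right h]
      have hX1 : X ≤ Θ₁ * X := by nlinarith
      have hhi1 : X0 ≤ X' := by rw [max_eq_right h] at hX0hi; exact hX0hi
      refine ⟨hX1, hc', hc', by nlinarith, hT, by linarith, by linarith, by linarith, ?_, ?_⟩
      · -- X0 − X ≤ X' − X ≤ η X ≤ η X0 ?  (X ≤ X0? not nec.) use: X0 ≤ X' ≤ X + ηX; if X ≤ X0 fine, else trivial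
        rcases le_or_gt X X0 with hx | hx
        · linarith [hηX0 X hx]
        · have : 0 ≤ η * X0 := mul_nonneg hη0 hX0pos.le
          linarith
      · -- X0 − X' ≤ 0
        have : 0 ≤ η * X0 := mul_nonneg hη0 hX0pos.le
        linarith
    · rw [min_eq_right h, max_eq_left h]
      have hX1 : X' ≤ Θ₁ * X' := by nlinarith
      have hhi1 : X0 ≤ X := by rw [max_eq_left h] at hX0hi; exact hX0hi
      refine ⟨hc, hX1, by nlinarith, hc, hT', by linarith, by linarith, by linarith, ?_, ?_⟩
      · have : 0 ≤ η * X0 := mul_nonneg hη0 hX0pos.le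
        linarith
      · rcases le_or_gt X' X0 with hx | hx
        · linarith [hηX0 X' hx]
        · have : 0 ≤ η * X0 := mul_nonneg hη0 hX0pos.le
          linarith
  obtain ⟨hminX, hminX', hmaxX, hmaxX', hminT, hmaxmin, hMlo, hMhi, hdX, hdX'⟩ := hfacts
  -- products with X0-bounds
  have p1 : Θ₁ * min X X' ≤ Θ₁ * (2 * X0) := mul_le_mul_of_nonneg_left hX0min hΘ0
  have p2 : η * min X X' ≤ η * (2 * X0) := mul_le_mul_of_nonneg_left hX0min hη0
  have p3 : 15 * δ * min X X' ≤ 15 * δ * (2 * X0) := mul_le_mul_of_nonneg_left hX0min (by positivity)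
  have hηX0 : 0 ≤ η * X0 := mul_nonneg hη0 hX0pos.le
  have hδX0 : 0 ≤ δ * X0 := mul_nonneg hδ0 hX0pos.le
  have hmin_le_X : X ≤ min X X' + η * min X X' := le_trans (le_max_left _ _) hmaxmin
  have hmin_le_X' : X' ≤ min X X' + η * min X X' := le_trans (le_max_right _ _) hmaxmin
  have hlo'' : min X X' - 15 * δ * min X X' ≤ X0 := by linarith only [hX0lo']
  have hXup : X - X0 ≤ 2 * (η + 15 * δ) * X0 := by
    linarith only [hmin_le_X, hlo'', p2, p3]
  have hX'up : X' - X0 ≤ 2 * (η + 15 * δ) * X0 := by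
    linarith only [hmin_le_X', hlo'', p2, p3]
  have hΘX : 0 ≤ Θ₁ * X := mul_nonneg hΘ0 hX.le
  have hΘX' : 0 ≤ Θ₁ * X' := mul_nonneg hΘ0 hX'.le
  refine ⟨hX0pos, by linarith only [hminX, p1], by linarith only [hX0hi, hmaxX, hΘX], by linarith only [hminX', p1],
    by linarith only [hX0hi, hmaxX', hΘX'], by linarith only [hminT, p1], ?_, ?_, ?_⟩
  · rw [div_sub_one hX0pos.ne']
    have hup : (X - X0) / X0 ≤ 2 * (η + 15 * δ) := by rw [div_le_iff₀ hX0pos]; exact hXup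
    have hdn : -(2 * (η + 15 * δ)) ≤ (X - X0) / X0 := by
      rw [le_div_iff₀ hX0pos]; linarith only [hdX, hηX0, hδX0]
    calc ((X - X0) / X0) ^ 2 ≤ (2 * (η + 15 * δ)) ^ 2 := sq_le_sq_of_abs_le hdn hup
      _ = 4 * (η + 15 * δ) ^ 2 := by ring
  · rw [div_sub_one hX0pos.ne']
    have hup : (X' - X0) / X0 ≤ 2 * (η + 15 * δ) := by rw [div_le_iff₀ hX0pos]; exact hX'up
    have hdn : -(2 * (η + 15 * δ)) ≤ (X' - X0) / X0 := by
      rw [le_div_iff₀ hX0pos]; linarith only [hdX', hηX0, hδX0]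
    calc ((X' - X0) / X0) ^ 2 ≤ (2 * (η + 15 * δ)) ^ 2 := sq_le_sq_of_abs_le hdn hup
      _ = 4 * (η + 15 * δ) ^ 2 := by ring
  · -- |X0 − M̄| ≤ (η + 15δ)·2 X0 ≤ (η+15δ)(2Θ₁) X0
    have hA : X0 - (X + X') / 2 ≤ η * (2 * X0) := by linarith only [hX0hi, hmaxmin, hMlo, p2]
    have hB : (X + X') / 2 - X0 ≤ (η + 15 * δ) * (2 * X0) := by linarith only [hMhi, hmaxmin, hlo'', p2, p3]
    have hC : (η + 15 * δ) * (2 * X0) ≤ (η + 15 * δ) * (2 * Θ₁) * X0 := by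
      have := mul_le_mul_of_nonneg_left hΘ₁ (by positivity : 0 ≤ (η + 15 * δ) * (2 * X0))
      linarith only [this]
    rw [abs_le]; constructor
    · linarith only [hB, hC]
    · linarith only [hA, hC, hδX0]

/-- QUOTIENT FORM of the doors (a)(b): `d^L ≤ X̃n^{L−1} ≤ e^{b}d^L`, `n > 0` ⟹ `(d/n)^L ≤ X̃/n` and `e^{−b}(X̃/n) ≤ (d/n)^L`. [folklore] -/
theorem quot_pow_bounds {d n X b : ℝ} {L : ℕ} (hL : 1 ≤ L) (hn : 0 < n) (hA : d ^ L ≤ X * n ^ (L - 1)) (hB : X * n ^ (L - 1) ≤ Real.exp b * d ^ L) :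
    (d / n) ^ L ≤ X / n ∧ Real.exp (-b) * (X / n) ≤ (d / n) ^ L := by
  obtain ⟨m, rfl⟩ : ∃ m, L = m + 1 := ⟨L - 1, by omega⟩
  rw [Nat.add_sub_cancel] at hA hB
  have hnp : 0 < n ^ (m + 1) := pow_pos hn _
  have hid : X / n = X * n ^ m / n ^ (m + 1) := by rw [pow_succ]; field_simp
  rw [div_pow, hid]
  constructor
  · exact div_le_div_of_nonneg_right hA hnp.le
  · rw [← mul_div_assoc, div_le_div_iff_of_pos_right hnp]
    have hE : 0 < Real.exp (-b) := Real.exp_pos _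
    have := mul_le_mul_of_nonneg_left hB hE.le
    have hee : Real.exp (-b) * (Real.exp b * d ^ (m + 1)) = d ^ (m + 1) := by
      rw [← mul_assoc, ← Real.exp_add, show -b + b = 0 by ring, Real.exp_zero, one_mul]
    rw [hee] at this
    calc Real.exp (-b) * (X * n ^ m) = Real.exp (-b) * X * n ^ m := by ring
      _ ≤ d ^ (m + 1) := by linarith [this]

/-! ## §3 ★ (o6) for a pair of channels -/

/-- (o6) END-GAME ARITHMETIC (clean context). [folklore] -/
theorem o6_numeric {mb l0 Lr X0 T E s η δ Θ₁ q Φ Φ' C lam2 R1 R2 : ℝ} (hmb0 : 0 ≤ mb) (hmb : mb ≤ l0) (hLr : 0 < Lr) (hX0 : 0 < X0)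
    (hT : T ≤ 2 * Θ₁ * X0) (hE : 0 ≤ E) (hs : 0 ≤ s) (hη : 0 ≤ η) (hδ : 0 ≤ δ) (hΘ₁ : 1 ≤ Θ₁) (hq : 0 ≤ q)
    (hΦ : Φ ≤ (32 * (2 * Θ₁) ^ 4 + 8 * (2 * Θ₁)) * δ + 32 * (2 * Θ₁) ^ 2 * (4 * (η + 15 * δ) ^ 2))
    (hΦ' : Φ' ≤ (32 * (2 * Θ₁) ^ 4 + 8 * (2 * Θ₁)) * δ + 32 * (2 * Θ₁) ^ 2 * (4 * (η + 15 * δ) ^ 2))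
    (hR1 : R1 = mb / (Lr * X0) * (E * T * q + (η + 15 * δ) * (2 * Θ₁) * X0 * (s * q)))
    (hR2 : R2 = mb / (2 * Lr) * (q * Φ + q * Φ'))
    (hC6 : 2 * Θ₁ * E + 2 * Θ₁ * (η + 15 * δ) * s + ((32 * (2 * Θ₁) ^ 4 + 8 * (2 * Θ₁)) * δ + 128 * (2 * Θ₁) ^ 2 * (η + 15 * δ) ^ 2) ≤ C * lam2) :
    R1 + R2 ≤ C * (lam2 / Lr) * l0 * q := by
  set Φs := (32 * (2 * Θ₁) ^ 4 + 8 * (2 * Θ₁)) * δ + 32 * (2 * Θ₁) ^ 2 * (4 * (η + 15 * δ) ^ 2) with hΦs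
  have hΘ0 : 0 ≤ Θ₁ := by linarith
  -- R1 ≤ (mb/Lr)·(2Θ₁ E + (η+15δ) 2Θ₁ s)·q
  have hTX : T / X0 ≤ 2 * Θ₁ := by rw [div_le_iff₀ hX0]; exact hT
  have hR1' : R1 ≤ mb / Lr * ((2 * Θ₁ * E + (η + 15 * δ) * (2 * Θ₁) * s) * q) := by
    rw [hR1]
    have hid : mb / (Lr * X0) * (E * T * q + (η + 15 * δ) * (2 * Θ₁) * X0 * (s * q)) =
        mb / Lr * ((T / X0 * E + (η + 15 * δ) * (2 * Θ₁) * s) * q) := by field_simp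
    rw [hid]
    apply mul_le_mul_of_nonneg_left _ (by positivity)
    apply mul_le_mul_of_nonneg_right _ hq
    nlinarith [mul_le_mul_of_nonneg_right hTX hE]
  -- R2 ≤ (mb/Lr)·Φs·q
  have hR2' : R2 ≤ mb / Lr * (Φs * q) := by
    rw [hR2]
    have hid : mb / (2 * Lr) * (q * Φ + q * Φ') = mb / Lr * ((Φ + Φ') / 2 * q) := by field_simp
    rw [hid]
    apply mul_le_mul_of_nonneg_left _ (by positivity)
    apply mul_le_mul_of_nonneg_right _ hq
    linarith
  have hΦs_id : Φs = (32 * (2 * Θ₁) ^ 4 + 8 * (2 * Θ₁)) * δ + 128 * (2 * Θ₁) ^ 2 * (η + 15 * δ) ^ 2 := by rw [hΦs]; ring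
  have hsum : (2 * Θ₁ * E + (η + 15 * δ) * (2 * Θ₁) * s) + Φs ≤ C * lam2 := by rw [hΦs_id]; linarith
  have hbr0 : 0 ≤ (2 * Θ₁ * E + (η + 15 * δ) * (2 * Θ₁) * s) + Φs := by positivity
  calc R1 + R2 ≤ mb / Lr * ((2 * Θ₁ * E + (η + 15 * δ) * (2 * Θ₁) * s) * q) + mb / Lr * (Φs * q) := add_le_add hR1' hR2'
    _ = mb / Lr * (((2 * Θ₁ * E + (η + 15 * δ) * (2 * Θ₁) * s) + Φs) * q) := by ring
    _ ≤ l0 / Lr * ((C * lam2) * q) := by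
        apply mul_le_mul (div_le_div_of_nonneg_right hmb hLr.le) (mul_le_mul_of_nonneg_right hsum hq) (by positivity)
          (div_nonneg (le_trans hmb0 hmb) hLr.le)
    _ = C * (lam2 / Lr) * l0 * q := by ring

end Summit.QuantumFields.YangMills.Theorems.FemtoTransferGap.PolyakovLift

end
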